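import Summits.Ventures.HSemireg.WedgeHankelRecurrenceWaringTop
import Summits.Ventures.HSemireg.WedgeHankelRecurrenceLinearComplexityCensus

/-!
# Venture HSemireg — THE TWO LENGTHS OF A CLASS, UNIFORMLY: over an algebraically closed field of characteristic `0`, **for EVERY `q` on EVERY `[0, N]` the least number of terms `T` of a sum of
# geometric sequences `q_j = Σ_{i<T} A_i λ_i^j` (`j ≤ N`, distinct nodes) exists and is `R^N(q)` or `N + 2 − R^N(q)`** (N66 inside the window, N68 at the top rank of an even level); the linear
# complexity `L` (N70) satisfies the same dichotomy and **`L ≤ T`, with `L < T` exactly for the AFFINE classes whose minimal recurrence has a REPEATED ROOT** (then `L = R`, `T = N + 2 − R`)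

HONEST FRAMING. Part of the Lean index of the computation cell `pub-hsemireg` (seat p10 gen 30, Sunday typer «UNIFORM-IN-n»).
LINEAR ALGEBRA OF HANKEL (catalecticant) MATRICES and of polynomials over a field ONLY: no variety, no cohomology theory, no sheaf, no Ext group and no semiregularity map is constructed
here; nothing here says that HC / HC_CM / HC_AV holds; no Literature fact is declared or used.  Custodian versions as in `WedgeHankelSiegelIdeal` (1/3); the dictionary («Waring rank» `T` and
«linear complexity ∕ length of the apolar generator prime to `y`» `L` of a binary form of degree `N`) is QUOTED in docstrings, never asserted; both are `IsLeast` values of inline sets.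

WHAT IS CHAINED.  N66 (`WedgeHankelRecurrenceWaringSylvester`, № 424): `isLeast_setOf_exists_secSeq_agree_of_separable` ∕ `_of_not_separable`; N68 (`WedgeHankelRecurrenceWaringTop`):
`isLeast_setOf_exists_secSeq_agree_top`; N70 (`WedgeHankelRecurrenceLinearComplexity`): `isLeast_setOf_lfsr_of_isAffineClass` ∕ `_of_isPolarClass` ∕ `_top`, `le_of_isLeast_setOf_lfsr_of_secSeq_agree`;
N71 (`WedgeHankelRecurrenceLinearComplexityCensus`): `IsPolarClass.add_le_succ`, `exists_isLeast_setOf_lfsr` (the linear complexity is `R` or `N + 2 − R`, every field); N43 (№ 323, tree)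
`isAffineClass_or_isPolarClass`; N61 (№ 391, tree) `prod_X_sub_C_mem_recSpace_of_secSeq_agree`; N19 (№ 174, tree) `prod_X_sub_C_nodes_ne_zero`, `natDegree_prod_X_sub_C_nodes`.  Mathlib: `IsLeast.unique`,
`Matrix.rank_le_height`, `Nat.cast_ne_zero`, `Polynomial.separable_prod_X_sub_C_iff`.
THIS FILE (namespace `Summit.Ventures.HSemireg.Wedge.HankelOuter` continued; CHAINED on N68 + N71; 0 definitions).  `T^N(q) := {t | ∃ (λ A : Fin t → K), λ injective ∧ ∀ j ≤ N, q_j = secSeq A λ j}`,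
`S^N(q) := {k | ∃ p ∈ Rec^N_k(q), p ≠ 0 ∧ deg p = k}` (inline), `R := R^N(q)`.
* §623 `rank_half_cases` (every field: `2R ≤ N + 1`, or `N = t + t` and `R = t + 1`).
* §624 `[IsAlgClosed K] [CharZero K]`: **`exists_isLeast_setOf_exists_secSeq_agree`** (EVERY `q`: `∃ T, IsLeast T^N(q) T ∧ (T = R ∨ T = N + 2 − R)`);
  **`isLeast_setOf_lfsr_le_isLeast_setOf_exists_secSeq_agree`** (`L ≤ T`, every field); **`isLeast_eq_or_of_isLeast`** (THE COMPARISON: `T = L`, or else the class is AFFINE with NO separable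
  full-degree minimal recurrence and `L = R < T = N + 2 − R`); `isLeast_eq_iff_of_isLeast` (`T = L ↔ ¬(IsAffineClass ∧ no separable full-degree generator)`).
Nothing Ext-side.  New names only.
-/

open Module Polynomial
open scoped Matrix Polynomial

namespace Summit.Ventures.HSemireg.Wedge.HankelOuter

open Summit.Ventures.HSemireg.Wedge Summit.Ventures.HSemireg.Wedge.Hankel Summit.Ventures.HSemireg.Wedge.HankelSecant

variable (K : Type*) [Field K] {N : ℕ}

/-! ## §623. The two regimes of the middle rank -/

/-- **EVERY CLASS IS INSIDE THE WINDOW OR AT THE TOP OF AN EVEN LEVEL: `2R^N(q) ≤ N + 1`, or `N = t + t` and `R^N(q) = t + 1`** (`R ≤ ⌊N/2⌋ + 1`). -/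
theorem rank_half_cases (q : ℕ → K) :
    (hankel1 K N (N / 2) q).rank + (hankel1 K N (N / 2) q).rank ≤ N + 1 ∨ ∃ t, N = t + t ∧ (hankel1 K N (N / 2) q).rank = t + 1 := by
  have hrle : (hankel1 K N (N / 2) q).rank ≤ N / 2 + 1 := Matrix.rank_le_height _
  obtain ⟨t, ht | ht⟩ : ∃ t, N = t + t ∨ N = t + t + 1 := ⟨N / 2, by omega⟩
  · by_cases h : (hankel1 K N (N / 2) q).rank = t + 1
    · exact Or.inr ⟨t, ht, h⟩
    · left; omega
  · left; omega

/-! ## §624. The least number of terms and the linear complexity, for every class -/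

/-- **SYLVESTER, UNIFORMLY: over an ALGEBRAICALLY CLOSED field of characteristic `0`, EVERY `q` on EVERY `[0, N]` has a least number of terms `T` (sums of geometric sequences with distinct
nodes agreeing with `q` on `[0, N]`), and `T = R^N(q)` or `T = N + 2 − R^N(q)`** (N66: `2R ≤ N + 1`, separable full-degree minimal recurrence or not; N68: top rank `t + 1 = R = N + 2 − R` of an
even level `N = 2t`). -/
theorem exists_isLeast_setOf_exists_secSeq_agree [IsAlgClosed K] [CharZero K] (q : ℕ → K) :
    ∃ T : ℕ, IsLeast {t : ℕ | ∃ (lam A : Fin t → K), Function.Injective lam ∧ ∀ j ≤ N, q j = secSeq K A lam j} T ∧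
      (T = (hankel1 K N (N / 2) q).rank ∨ T = N + 2 - (hankel1 K N (N / 2) q).rank) := by
  rcases rank_half_cases K (N := N) q with h2 | ⟨t, ht, hq⟩
  · by_cases hsep : ∃ m ∈ recSpace K N q (hankel1 K N (N / 2) q).rank, m ≠ 0 ∧ m.natDegree = (hankel1 K N (N / 2) q).rank ∧ m.Separable
    · exact ⟨_, isLeast_setOf_exists_secSeq_agree_of_separable K rfl h2 hsep, Or.inl rfl⟩
    · exact ⟨_, isLeast_setOf_exists_secSeq_agree_of_not_separable K rfl h2 (Nat.cast_ne_zero.mpr (by omega)) hsep, Or.inr rfl⟩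
  · subst ht
    refine ⟨t + 1, ?_, Or.inl hq.symm⟩
    exact isLeast_setOf_exists_secSeq_agree_top K hq (Nat.cast_ne_zero.mpr (Nat.succ_ne_zero t))

/-- **`L ≤ T`: the linear complexity never exceeds the number of terms** (every field; the node polynomial of a `T`-term sum is a full-degree recurrence of window `T + 1`). -/
theorem isLeast_setOf_lfsr_le_isLeast_setOf_exists_secSeq_agree {q : ℕ → K} {L T : ℕ} (hL : IsLeast {k : ℕ | ∃ p ∈ recSpace K N q k, p ≠ 0 ∧ p.natDegree = k} L)
    (hT : IsLeast {t : ℕ | ∃ (lam A : Fin t → K), Function.Injective lam ∧ ∀ j ≤ N, q j = secSeq K A lam j} T) : L ≤ T := by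
  obtain ⟨lam, A, hlam, hrep⟩ := hT.1
  exact le_of_isLeast_setOf_lfsr_of_secSeq_agree K hL hlam hrep

/-- **THE COMPARISON: over an algebraically closed field of characteristic `0`, the least number of terms `T` EQUALS the linear complexity `L`, EXCEPT for the AFFINE classes with NO separable
full-degree minimal recurrence (a repeated root), where `L = R^N(q) < T = N + 2 − R^N(q)`.** -/
theorem isLeast_eq_or_of_isLeast [IsAlgClosed K] [CharZero K] {q : ℕ → K} {L T : ℕ} (hL : IsLeast {k : ℕ | ∃ p ∈ recSpace K N q k, p ≠ 0 ∧ p.natDegree = k} L)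
    (hT : IsLeast {t : ℕ | ∃ (lam A : Fin t → K), Function.Injective lam ∧ ∀ j ≤ N, q j = secSeq K A lam j} T) :
    T = L ∨ (IsAffineClass K N (hankel1 K N (N / 2) q).rank q ∧
      (¬ ∃ m ∈ recSpace K N q (hankel1 K N (N / 2) q).rank, m ≠ 0 ∧ m.natDegree = (hankel1 K N (N / 2) q).rank ∧ m.Separable) ∧
      L = (hankel1 K N (N / 2) q).rank ∧ T = N + 2 - (hankel1 K N (N / 2) q).rank ∧ L < T) := by
  set r := (hankel1 K N (N / 2) q).rank with hr
  rcases rank_half_cases K (N := N) q with h2 | ⟨t, ht, hq⟩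
  · rw [← hr] at h2
    by_cases hsep : ∃ m ∈ recSpace K N q r, m ≠ 0 ∧ m.natDegree = r ∧ m.Separable
    · -- separable full-degree generator: affine, `T = r = L`
      have hT' := isLeast_setOf_exists_secSeq_agree_of_separable K hr.symm h2 hsep
      obtain ⟨m, hm, hm0, hmd, -⟩ := hsep
      have hA : IsAffineClass K N r q := ⟨hr.symm, m, hm, hm0, hmd⟩
      exact Or.inl ((hT.unique hT').trans (hL.unique (isLeast_setOf_lfsr_of_isAffineClass K hA)).symm)
    · have hT' := isLeast_setOf_exists_secSeq_agree_of_not_separable K hr.symm h2 (Nat.cast_ne_zero.mpr (by omega)) hsep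
      have hTv : T = N + 2 - r := hT.unique hT'
      rcases isAffineClass_or_isPolarClass K hr.symm with hA | hP
      · have hLv : L = r := hL.unique (isLeast_setOf_lfsr_of_isAffineClass K hA)
        exact Or.inr ⟨hA, hsep, hLv, hTv, by omega⟩
      · have hLv : L = N + 2 - r := hL.unique (isLeast_setOf_lfsr_of_isPolarClass K hP h2)
        exact Or.inl (hTv.trans hLv.symm)
  · -- top rank of an even level: both are `t + 1`
    subst ht
    rw [← hr] at hq
    have hq' : (hankel1 K (t + t) ((t + t) / 2) q).rank = t + 1 := hq
    have hTv : T = t + 1 := hT.unique (isLeast_setOf_exists_secSeq_agree_top K hq' (Nat.cast_ne_zero.mpr (Nat.succ_ne_zero t)))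
    have hLv : L = t + 1 := hL.unique (isLeast_setOf_lfsr_top K hq')
    exact Or.inl (hTv.trans hLv.symm)

/-- **… so `T = L` iff the class is not an affine class lacking a separable full-degree minimal recurrence** (if `T = L = R` for an affine class, the node polynomial of a minimal
representation is a separable full-degree member of the minimal window). -/
theorem isLeast_eq_iff_of_isLeast [IsAlgClosed K] [CharZero K] {q : ℕ → K} {L T : ℕ} (hL : IsLeast {k : ℕ | ∃ p ∈ recSpace K N q k, p ≠ 0 ∧ p.natDegree = k} L)
    (hT : IsLeast {t : ℕ | ∃ (lam A : Fin t → K), Function.Injective lam ∧ ∀ j ≤ N, q j = secSeq K A lam j} T) :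
    T = L ↔ ¬ (IsAffineClass K N (hankel1 K N (N / 2) q).rank q ∧
      ¬ ∃ m ∈ recSpace K N q (hankel1 K N (N / 2) q).rank, m ≠ 0 ∧ m.natDegree = (hankel1 K N (N / 2) q).rank ∧ m.Separable) := by
  constructor
  · rintro hTL ⟨hA, hsep⟩
    have hLv : L = (hankel1 K N (N / 2) q).rank := hL.unique (isLeast_setOf_lfsr_of_isAffineClass K hA)
    have hT1 := hT.1
    rw [hTL, hLv] at hT1
    obtain ⟨lam, A, hlam, hrep⟩ := hT1
    exact hsep ⟨_, prod_X_sub_C_mem_recSpace_of_secSeq_agree K hlam hrep, prod_X_sub_C_nodes_ne_zero K lam, natDegree_prod_X_sub_C_nodes K lam,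
      Polynomial.separable_prod_X_sub_C_iff.mpr hlam⟩
  · intro h
    rcases isLeast_eq_or_of_isLeast K hL hT with h' | ⟨hA, hsep, -, -, -⟩
    · exact h'
    · exact absurd ⟨hA, hsep⟩ h

end Summit.Ventures.HSemireg.Wedge.HankelOuter
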